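import Literature.AlgebraicGeometry.Resolution.ResolutionOfSingularities
import Mathlib.AlgebraicGeometry.AffineScheme
import Mathlib.RingTheory.Filtration
import Mathlib.RingTheory.Localization.AtPrime.Basic
import Mathlib.RingTheory.Ideal.GoingUp
import Mathlib.RingTheory.IntegralClosure.IsIntegralClosure.Basic
import Mathlib.FieldTheory.IsAlgClosed.AlgebraicClosure
import Mathlib.FieldTheory.RatFunc.Basic
import Mathlib.Algebra.Polynomial.Div
import Mathlib.Algebra.Field.ZMod
import Mathlib.Algebra.CharP.Defs
import HarnessLib

/-!
# Absolutely integrally closed schemes have no resolution: finite type is necessary in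
# `ResolutionInChar`

Topic: `Literature/AlgebraicGeometry/Resolution`. A formal justification of the design choice
"of finite type" in the summit statement (`ResolutionOfSingularities.lean`, §Design choices),
recorded as negative knowledge by the standing disprover of crux `PatchingRel`
(stmt-ResolutionOfSingularities-0642, `Cruxes/PatchingRel/Disproof.lean` §3): the consequent
`ResolutionInChar p` with the hypothesis `LocallyOfFiniteType f` dropped is FALSE, for every
prime `p`. Companion of `NonReducedNoResolution.lean` (`IsReduced` dropped).

The mechanism is the folklore fact that perfect — more generally, root-closed — rings are
Noetherian only trivially:

* `Ideal.eq_bot_of_forall_exists_pow_eq` — in a domain `R` in which every element is an `n`-th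
  power for some fixed `n ≥ 2` (e.g. a perfect domain of characteristic `p`, or an absolutely
  integrally closed domain), a prime `Q` with NOETHERIAN localisation `R_Q` is zero: the maximal
  ideal `m` of `R_Q` satisfies `m ⊆ mⁿ ⊆ m²`, so `m = m²`, so `m = 0` by Krull's intersection
  theorem (`Ideal.isIdempotentElem_iff_eq_bot_or_top_of_isLocalRing`).
* `exists_dense_forall_isRegularLocalRing_of_hasResolution` — if `X` has a resolution
  (`Scheme.HasResolution`: proper, birational = isomorphism over a dense open with dense preimage,
  regular source) then every point of some dense open of `X` has a regular local ring.
* `not_hasResolution_spec_of_forall_exists_pow_eq` — hence `Spec R` has NO resolution when `R` is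
  such a root-closed domain whose generic point is not open (every `f ≠ 0` avoids some non-zero
  prime): a dense open contains some `D(f)`, `f ≠ 0`, hence a non-generic point with regular,
  in particular Noetherian, stalk — impossible.
* The witness over `𝔽_p`: `R = ` the integral closure of `𝔽_p[X]` in an algebraic closure of
  `𝔽_p(X)` (the absolute integral closure `𝔽_p[X]⁺`). Every element of `R` is a square
  (`absoluteIntegralClosure_exists_sq_eq`, roots of integral elements are integral), and every
  `f ≠ 0` avoids a non-zero prime (`absoluteIntegralClosure_exists_prime_not_mem`: lying over a
  prime `(π)` of `𝔽_p[X]` not dividing the constant term of an integral equation of `f`).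
* `not_hasResolution_spec_absoluteIntegralClosure`, `not_resolutionInChar_without_locallyOfFiniteType`
  — `Spec 𝔽_p[X]⁺ → Spec 𝔽_p` is affine (separated, quasi-compact) and reduced, and has no
  resolution.

Moral for the resolution routes (`PAlteration`, `Descent`, `Valuative`): passing to a perfection
or an absolute integral closure destroys regularity at every non-generic point, so "resolve after
perfection and descend" cannot be phrased with `Scheme.IsRegular`; and any proof of `PatchingRel`
must use the finite type of `X → Spec k` (it is what makes the Riemann–Zariski space of the
function field the right parameter space and the local rings Noetherian).

## Sources

* M. Artin, *On the joins of Hensel rings*, Adv. Math. 7 (1971) 282–296 (absolute integral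
  closure). The Noetherian-perfect-local-ring-is-a-field argument is folklore.
* The Stacks Project, Tag 01RN (birational), Tag 02IS (regular schemes), Tag 00FZ (lying over).

No new definitions: the witness ring is written out as
`↥(integralClosure (ZMod p)[X] (AlgebraicClosure (RatFunc (ZMod p))))`.
-/

noncomputable section

open CategoryTheory AlgebraicGeometry

namespace Literature.AlgebraicGeometry.Resolution

/-- **Root-closed domains are Noetherian only at the generic point.** In a domain in which every
element is an `n`-th power for some `n ≥ 2`, a prime ideal whose localisation is Noetherian is
zero: the maximal ideal `m` of `R_Q` satisfies `m ≤ mⁿ ≤ m²`, so it is idempotent, hence `⊥` by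
Krull's intersection theorem. [folklore] -/
theorem Ideal.eq_bot_of_forall_exists_pow_eq {R : Type*} [CommRing R] [IsDomain R] {n : ℕ}
    (hn : 2 ≤ n) (hpow : ∀ a : R, ∃ b : R, b ^ n = a) (Q : Ideal R) [Q.IsPrime]
    [IsNoetherianRing (Localization.AtPrime Q)] : Q = ⊥ := by
  set S := Localization.AtPrime Q
  set m := IsLocalRing.maximalIdeal S with hm
  have hle : m ≤ m ^ 2 := by
    intro x hx
    obtain ⟨⟨a, s⟩, rfl⟩ := IsLocalization.mk'_surjective Q.primeCompl x
    change IsLocalization.mk' S a s ∈ m at hx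
    change IsLocalization.mk' S a s ∈ m ^ 2
    have ha : a ∈ Q := (IsLocalization.AtPrime.mk'_mem_maximal_iff S Q a s).mp hx
    obtain ⟨b, hb⟩ := hpow a
    have hbQ : b ∈ Q := ‹Q.IsPrime›.mem_of_pow_mem n (hb ▸ ha)
    have hbm : algebraMap R S b ∈ m := (IsLocalization.AtPrime.to_map_mem_maximal_iff S Q b).mpr hbQ
    have hx' : IsLocalization.mk' S a s = (algebraMap R S b) ^ n * IsLocalization.mk' S 1 s := by
      rw [← map_pow, hb, ← IsLocalization.mk'_one (M := Q.primeCompl) S a, ← IsLocalization.mk'_mul,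
        mul_one, one_mul]
    rw [hx']
    refine Ideal.mul_mem_right _ _ ?_
    have : (algebraMap R S b) ^ n ∈ m ^ n := Ideal.pow_mem_pow hbm n
    exact Ideal.pow_le_pow_right hn this
  have hidem : IsIdempotentElem m := by
    refine le_antisymm Ideal.mul_le_right ?_
    simpa only [pow_two] using hle
  rcases (Ideal.isIdempotentElem_iff_eq_bot_or_top_of_isLocalRing m).mp hidem with h | h
  · refine eq_bot_iff.mpr fun q hq => ?_
    have hqm : algebraMap R S q ∈ m := (IsLocalization.AtPrime.to_map_mem_maximal_iff S Q q).mpr hq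
    rw [h, Ideal.mem_bot] at hqm
    have hinj : Function.Injective (algebraMap R S) :=
      IsLocalization.injective S Q.primeCompl_le_nonZeroDivisors
    exact (Ideal.mem_bot).mpr (hinj (by rw [hqm, map_zero]))
  · exact absurd h (IsLocalRing.maximalIdeal.isMaximal S).ne_top

universe u

/-- **If `X` has a resolution, every point of some dense open of `X` has a regular local ring**:
transport regularity of the stalks of `X'` along `π⁻¹U ≅ U` and the open immersions
(`Scheme.HasResolution`, `IsBirational`: Stacks 01RN). [folklore] -/
theorem exists_dense_forall_isRegularLocalRing_of_hasResolution {X : Scheme.{u}}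
    (h : Scheme.HasResolution X) :
    ∃ U : X.Opens, Dense (U : Set X) ∧ ∀ x : X, x ∈ U → IsRegularLocalRing (X.presheaf.stalk x) := by
  obtain ⟨X', π, hπ⟩ := h
  obtain ⟨U, hUd, -, hUiso⟩ := hπ.isBirational
  refine ⟨U, hUd, fun x hx => ?_⟩
  haveI := hUiso
  let u : (U : Scheme.{u}) := ⟨x, hx⟩
  let e := asIso (π ∣_ U)
  let v := e.inv.base u
  have h1 : IsRegularLocalRing (X'.presheaf.stalk ((π ⁻¹ᵁ U).ι.base v)) := hπ.isRegular _
  have h2 : IsRegularLocalRing ((↑(π ⁻¹ᵁ U) : Scheme.{u}).presheaf.stalk v) :=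
    IsRegularLocalRing.of_ringEquiv (asIso ((π ⁻¹ᵁ U).ι.stalkMap v)).commRingCatIsoToRingEquiv
  have h3 : IsRegularLocalRing ((U : Scheme.{u}).presheaf.stalk u) :=
    IsRegularLocalRing.of_ringEquiv (asIso (e.inv.stalkMap u)).commRingCatIsoToRingEquiv
  exact IsRegularLocalRing.of_ringEquiv (asIso (U.ι.stalkMap u)).commRingCatIsoToRingEquiv.symm

/-- **The spectrum of a root-closed domain with non-open generic point has no resolution of
singularities**: a dense open contains a basic open `D(f)`, `f ≠ 0`, hence (hypothesis `hG`) a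
NON-generic point `Q ∌ f`, whose stalk `R_Q` would be a regular, in particular Noetherian, local
ring — forcing `Q = 0` (`Ideal.eq_bot_of_forall_exists_pow_eq`). [folklore] -/
theorem not_hasResolution_spec_of_forall_exists_pow_eq (R : Type u) [CommRing R] [IsDomain R]
    {n : ℕ} (hn : 2 ≤ n) (hpow : ∀ a : R, ∃ b : R, b ^ n = a)
    (hG : ∀ f : R, f ≠ 0 → ∃ Q : Ideal R, Q.IsPrime ∧ Q ≠ ⊥ ∧ f ∉ Q) :
    ¬ Scheme.HasResolution (Spec (.of R)) := by
  intro h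
  obtain ⟨U, hUd, hU⟩ := exists_dense_forall_isRegularLocalRing_of_hasResolution h
  obtain ⟨x, hx⟩ := hUd.nonempty
  obtain ⟨_, ⟨f, rfl⟩, hxf, hfU⟩ :=
    (PrimeSpectrum.isTopologicalBasis_basic_opens (R := R)).exists_subset_of_mem_open hx U.isOpen
  have hf0 : f ≠ 0 := by
    rintro rfl
    exact (PrimeSpectrum.mem_basicOpen _ _).mp hxf (Ideal.zero_mem _)
  obtain ⟨Q, hQ, hQne, hfQ⟩ := hG f hf0
  let y : PrimeSpectrum R := ⟨Q, hQ⟩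
  have hyU : (y : ↑(Spec (.of R))) ∈ (U : Set ↑(Spec (.of R))) :=
    hfU ((PrimeSpectrum.mem_basicOpen _ _).mpr hfQ)
  have hreg : IsRegularLocalRing ((Spec (.of R)).presheaf.stalk y) := hU y hyU
  haveI : IsRegularLocalRing (Localization.AtPrime Q) :=
    IsRegularLocalRing.of_ringEquiv (Spec.stalkIso (.of R) y).commRingCatIsoToRingEquiv
  exact hQne (Ideal.eq_bot_of_forall_exists_pow_eq hn hpow Q)

/-! ## The witness: the absolute integral closure of `𝔽_p[X]`

Written out as the subalgebra `integralClosure (ZMod p)[X] (AlgebraicClosure (RatFunc (ZMod p)))`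
(no definition is introduced); `p` prime. -/

section Witness

open Polynomial

variable (p : ℕ) [Fact p.Prime]

/-- `𝔽_p[X] → 𝔽_p[X]⁺` is injective (it factors the injection into the algebraic closure of
`𝔽_p(X)`). [folklore] -/
theorem absoluteIntegralClosure_algebraMap_injective :
    Function.Injective (algebraMap (ZMod p)[X]
      ↥(integralClosure (ZMod p)[X] (AlgebraicClosure (RatFunc (ZMod p))))) := by
  have h : Function.Injective (algebraMap (ZMod p)[X] (AlgebraicClosure (RatFunc (ZMod p)))) := by
    rw [IsScalarTower.algebraMap_eq (ZMod p)[X] (RatFunc (ZMod p)) (AlgebraicClosure (RatFunc (ZMod p)))]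
    exact (algebraMap (RatFunc (ZMod p)) _).injective.comp (RatFunc.algebraMap_injective (ZMod p))
  intro a b hab
  apply h
  have := congrArg
    (fun x : ↥(integralClosure (ZMod p)[X] (AlgebraicClosure (RatFunc (ZMod p)))) =>
      (x : AlgebraicClosure (RatFunc (ZMod p)))) hab
  simpa using this

/-- **Every element of `𝔽_p[X]⁺` is a square**: square roots exist in the algebraic closure and
roots of integral elements are integral (`IsIntegral.of_pow`). [folklore] -/
theorem absoluteIntegralClosure_exists_sq_eq
    (a : ↥(integralClosure (ZMod p)[X] (AlgebraicClosure (RatFunc (ZMod p))))) :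
    ∃ b : ↥(integralClosure (ZMod p)[X] (AlgebraicClosure (RatFunc (ZMod p)))), b ^ 2 = a := by
  obtain ⟨z, hz⟩ := IsAlgClosed.exists_pow_nat_eq (a : AlgebraicClosure (RatFunc (ZMod p))) two_pos
  have hzint : IsIntegral (ZMod p)[X] z := IsIntegral.of_pow two_pos (by rw [hz]; exact a.2)
  exact ⟨⟨z, hzint⟩, Subtype.ext hz⟩

/-- **The generic point of `Spec 𝔽_p[X]⁺` is not open**: every non-zero `f` avoids some non-zero
prime — a prime lying over `(π)`, where `π` is an irreducible factor of `c·X + 1` and `c ≠ 0` is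
the constant term of an integral equation of `f` (if `f ∈ Q` then `c ∈ Q ∩ 𝔽_p[X] = (π)`, but
`π ∤ c`). (Lying over: Stacks 00FZ.) [folklore] -/
theorem absoluteIntegralClosure_exists_prime_not_mem
    (f : ↥(integralClosure (ZMod p)[X] (AlgebraicClosure (RatFunc (ZMod p))))) (hf : f ≠ 0) :
    ∃ Q : Ideal ↥(integralClosure (ZMod p)[X] (AlgebraicClosure (RatFunc (ZMod p)))),
      Q.IsPrime ∧ Q ≠ ⊥ ∧ f ∉ Q := by
  have hinj := absoluteIntegralClosure_algebraMap_injective p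
  -- an integral equation of `f` with non-zero constant term `c`
  obtain ⟨P, hPm, hPf⟩ := (integralClosure.isIntegral f : IsIntegral (ZMod p)[X] f)
  obtain ⟨P', hP, hXP'⟩ := P.exists_eq_pow_rootMultiplicity_mul_and_not_dvd hPm.ne_zero 0
  simp only [map_zero, sub_zero] at hP hXP'
  set c := P'.coeff 0 with hc_def
  have hc : c ≠ 0 := fun h0 => hXP' (Polynomial.X_dvd_iff.mpr h0)
  have hP'f : Polynomial.aeval f P' = 0 := by
    have h1 : Polynomial.aeval f P = 0 := hPf
    rw [hP, map_mul, map_pow, Polynomial.aeval_X] at h1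
    exact (mul_eq_zero.mp h1).resolve_left (pow_ne_zero _ hf)
  have hrel : algebraMap (ZMod p)[X] _ c = -(Polynomial.aeval f P'.divX * f) := by
    have h1 := hP'f
    rw [← Polynomial.divX_mul_X_add P', map_add, map_mul, Polynomial.aeval_X,
      Polynomial.aeval_C] at h1
    linear_combination h1
  -- a non-zero prime `(π)` of `𝔽_p[X]` with `π ∤ c`: an irreducible factor of `c·X + 1`
  have hdeg : (c * X + 1 : (ZMod p)[X]).natDegree = c.natDegree + 1 := by
    rw [Polynomial.natDegree_add_eq_left_of_natDegree_lt] <;>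
      rw [Polynomial.natDegree_mul_X hc]
    simp
  have hne : (c * X + 1 : (ZMod p)[X]) ≠ 0 := by
    intro h0; rw [h0] at hdeg; simp at hdeg
  have hnu : ¬ IsUnit (c * X + 1 : (ZMod p)[X]) := by
    intro hu
    have := Polynomial.natDegree_eq_zero_of_isUnit hu
    omega
  obtain ⟨π, hπirr, hπdvd⟩ := WfDvdMonoid.exists_irreducible_factor hnu hne
  have hπc : ¬ π ∣ c := by
    intro hdc
    apply hπirr.not_isUnit
    have : π ∣ (c * X + 1) - c * X := dvd_sub hπdvd (dvd_mul_of_dvd_left hdc _)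
    exact isUnit_of_dvd_one (by simpa using this)
  let 𝔭 : Ideal (ZMod p)[X] := Ideal.span {π}
  haveI h𝔭 : 𝔭.IsPrime := (Ideal.span_singleton_prime hπirr.ne_zero).mpr hπirr.prime
  -- lying over `𝔭`
  obtain ⟨Q, -, hQ, hQcomap⟩ := Ideal.exists_ideal_over_prime_of_isIntegral 𝔭
    (⊥ : Ideal ↥(integralClosure (ZMod p)[X] (AlgebraicClosure (RatFunc (ZMod p)))))
    (by
      intro a ha
      have ha0 : algebraMap (ZMod p)[X]
          ↥(integralClosure (ZMod p)[X] (AlgebraicClosure (RatFunc (ZMod p)))) a = 0 := by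
        simpa [Ideal.mem_comap] using ha
      have : a = 0 := hinj (by rw [ha0, map_zero])
      rw [this]; exact 𝔭.zero_mem)
  refine ⟨Q, hQ, ?_, ?_⟩
  · rintro rfl
    have hπmem : π ∈ (⊥ : Ideal ↥(integralClosure (ZMod p)[X]
        (AlgebraicClosure (RatFunc (ZMod p))))).comap (algebraMap (ZMod p)[X] _) := by
      rw [hQcomap]; exact Ideal.mem_span_singleton_self π
    have hπ0 : algebraMap (ZMod p)[X]
        ↥(integralClosure (ZMod p)[X] (AlgebraicClosure (RatFunc (ZMod p)))) π = 0 := by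
      simpa [Ideal.mem_comap] using hπmem
    exact hπirr.ne_zero (hinj (by rw [hπ0, map_zero]))
  · intro hfQ
    have h1 : algebraMap (ZMod p)[X] _ c ∈ Q := by
      rw [hrel]; exact Q.neg_mem (Q.mul_mem_left _ hfQ)
    have h2 : c ∈ 𝔭 := by rw [← hQcomap]; exact h1
    exact hπc (Ideal.mem_span_singleton.mp h2)

/-- **`Spec 𝔽_p[X]⁺` (the absolute integral closure of the affine line over `𝔽_p`) has no
resolution of singularities** in the sense of `Scheme.HasResolution`. [folklore] -/
theorem not_hasResolution_spec_absoluteIntegralClosure :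
    ¬ Scheme.HasResolution
      (Spec (.of ↥(integralClosure (ZMod p)[X] (AlgebraicClosure (RatFunc (ZMod p)))))) :=
  not_hasResolution_spec_of_forall_exists_pow_eq _ le_rfl (absoluteIntegralClosure_exists_sq_eq p)
    (absoluteIntegralClosure_exists_prime_not_mem p)

/-- **`ResolutionInChar p` without `LocallyOfFiniteType` is false** for every prime `p`: the
statement of `ResolutionInChar` with the finite-type hypothesis dropped fails at
`Spec 𝔽_p[X]⁺ → Spec 𝔽_p` (affine, hence separated and quasi-compact; reduced, being the
spectrum of a domain). Negative knowledge for crux stmt-ResolutionOfSingularities-0642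
(`PatchingRel`): the consequent's finite-type hypothesis is load-bearing. [folklore] -/
theorem not_resolutionInChar_without_locallyOfFiniteType :
    ¬ ∀ (k : Type) [Field k] [CharP k p] (X : Scheme.{0}) (f : X ⟶ Spec (.of k)),
      IsSeparated f → QuasiCompact f → IsReduced X → Scheme.HasResolution X := by
  intro h
  let f : Spec (.of ↥(integralClosure (ZMod p)[X] (AlgebraicClosure (RatFunc (ZMod p))))) ⟶
      Spec (.of (ZMod p)) :=
    Spec.map (CommRingCat.ofHom ((algebraMap (ZMod p)[X]
      ↥(integralClosure (ZMod p)[X] (AlgebraicClosure (RatFunc (ZMod p))))).comp Polynomial.C))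
  exact not_hasResolution_spec_absoluteIntegralClosure p
    (h (ZMod p) _ f inferInstance inferInstance inferInstance)

end Witness

end Literature.AlgebraicGeometry.Resolution

end
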